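import Literature.RingTheory.Flat.LocalCriterion
import Literature.RingTheory.Flat.GenericFreenessProofs
import Mathlib.Topology.NoetherianSpace
import Mathlib.Topology.Sober
import Mathlib.RingTheory.Spectrum.Prime.Topology
import Mathlib.RingTheory.Spectrum.Prime.Noetherian
import Mathlib.RingTheory.Localization.BaseChange
import Mathlib.RingTheory.Flat.Localization
import Mathlib.RingTheory.Flat.Tensor
import Mathlib.Algebra.Module.LocalizedModule.Submodule
import Mathlib.LinearAlgebra.TensorProduct.Quotient
import Mathlib.RingTheory.Ideal.Maps
import Mathlib.Algebra.Module.Torsion.Basic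
import Mathlib.RingTheory.FiniteType
import Mathlib.RingTheory.Localization.AtPrime.Basic
import Mathlib.RingTheory.LocalProperties.Basic
import Mathlib.RingTheory.Ideal.Quotient.Noetherian
import Mathlib.RingTheory.Localization.Finiteness
import Mathlib.RingTheory.Localization.Submodule
import HarnessLib

/-!
# Openness of the flat locus (Matsumura, Thm. 24.3; Stacks 00RC, Noetherian case)

## Main results

* `isOpen_of_stableUnderGeneralization_of_nhds_inter_closure` (**topological Nagata criterion**,
  Matsumura Thm. 24.2, for Noetherian quasi-sober spaces): `U` is open as soon as it is stable
  under generalization and, for every `x ∈ U`, contains `O ∩ closure {x}` for some open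
  neighbourhood `O` of `x`.
* `injective_lTensor_iff_forall_exists_smul_eq_zero`: localization over `B` commutes with
  `N ⊗_A (-)` and kernels (torsion description of `Ker(N_S ⊗_A X′ → N_S ⊗_A X)`).
* `exists_flat_quotient_tensor_localizedModule`: generic flatness of the fibre `N/pN` over `A/p`
  (from generic freeness, `GortzWedhorn2020_10_83_holds`).
* `isOpen_setOf_flat_localizedModule` (**Matsumura Thm. 24.3**): for `A` Noetherian, `B` of finite
  type over `A` and `N` a finite `B`-module, `{Q ∈ Spec B | N_Q is flat over A}` is open.

## References

* [H. Matsumura, *Commutative Ring Theory*, Thms. 24.2, 24.3][Matsumura1987]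
* [U. Görtz, T. Wedhorn, *Algebraic Geometry I*, Thm. 10.83][GortzWedhorn2020]
* The Stacks Project, Tag 00RC.
-/

namespace Literature.RingTheory.Flat

open TopologicalSpace

/-- **Topological Nagata criterion** (Matsumura, *Commutative Ring Theory*, Thm. 24.2, stated for
Noetherian quasi-sober spaces, e.g. `Spec` of a Noetherian ring): a subset `U` which is stable
under generalization and such that every `x ∈ U` has an open neighbourhood `O` with
`O ∩ closure {x} ⊆ U` is open. (Proof by Noetherian induction on closed subsets `Z`, for the
property "`Z ∖ U` is closed": a minimal bad `Z` is irreducible, with generic point `ξ`; if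
`ξ ∉ U` then `Z ∩ U = ∅` by stability under generalization, and if `ξ ∈ U` then `Z ∖ U = (Z ∖ O) ∖ U`
for the neighbourhood `O` of `ξ`.) [cite: Matsumura1987, Thm. 24.2] -/
theorem isOpen_of_stableUnderGeneralization_of_nhds_inter_closure {X : Type*} [TopologicalSpace X]
    [NoetherianSpace X] [QuasiSober X] {U : Set X} (h₁ : StableUnderGeneralization U)
    (h₂ : ∀ x ∈ U, ∃ O : Set X, IsOpen O ∧ x ∈ O ∧ O ∩ closure {x} ⊆ U) : IsOpen U := by
  classical
  -- Noetherian induction on closed subsets, for the property "`Z ∖ U` is closed"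
  let bad : Set (Closeds X) := {Z | ¬IsClosed ((Z : Set X) \ U)}
  suffices hbad : bad = ∅ by
    have huniv : (⟨Set.univ, isClosed_univ⟩ : Closeds X) ∉ bad := by rw [hbad]; exact id
    simp only [bad, Set.mem_setOf_eq, not_not, Closeds.coe_mk] at huniv
    rw [← Set.compl_eq_univ_sdiff] at huniv
    simpa using huniv.isOpen_compl
  by_contra hne
  obtain ⟨Z₀, hZ₀, hmin⟩ := (wellFounded_lt (α := Closeds X)).has_min bad
    (Set.nonempty_iff_ne_empty.mpr hne)
  have hgood : ∀ Z : Closeds X, Z < Z₀ → IsClosed ((Z : Set X) \ U) := fun Z hZ => by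
    by_contra h
    exact hmin Z h hZ
  apply hZ₀
  -- `Z₀` is nonempty
  by_cases hempty : (Z₀ : Set X) = ∅
  · rw [hempty, Set.empty_sdiff]; exact isClosed_empty
  have hnonempty : (Z₀ : Set X).Nonempty := Set.nonempty_iff_ne_empty.mpr hempty
  -- `Z₀` is irreducible
  by_cases hirr : IsIrreducible (Z₀ : Set X)
  swap
  · have hpre : ¬IsPreirreducible (Z₀ : Set X) := fun h => hirr ⟨hnonempty, h⟩
    simp only [IsPreirreducible, not_forall, exists_prop, Set.not_nonempty_iff_eq_empty] at hpre
    obtain ⟨u, v, hu, hv, hZu, hZv, huv⟩ := hpre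
    let Z₁ : Closeds X := ⟨(Z₀ : Set X) \ u, Z₀.isClosed.sdiff hu⟩
    let Z₂ : Closeds X := ⟨(Z₀ : Set X) \ v, Z₀.isClosed.sdiff hv⟩
    have hZ₁ : Z₁ < Z₀ := by
      rw [SetLike.lt_iff_le_and_exists]
      refine ⟨fun z hz => hz.1, ?_⟩
      obtain ⟨z, hz, hzu⟩ := hZu
      exact ⟨z, hz, fun h => h.2 hzu⟩
    have hZ₂ : Z₂ < Z₀ := by
      rw [SetLike.lt_iff_le_and_exists]
      refine ⟨fun z hz => hz.1, ?_⟩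
      obtain ⟨z, hz, hzv⟩ := hZv
      exact ⟨z, hz, fun h => h.2 hzv⟩
    have hcover : (Z₀ : Set X) = (Z₁ : Set X) ∪ (Z₂ : Set X) := by
      ext z
      simp only [Z₁, Z₂, Closeds.coe_mk, Set.mem_union, Set.mem_sdiff]
      constructor
      · intro hz
        by_cases hzu : z ∈ u
        · right
          exact ⟨hz, fun hzv => (Set.eq_empty_iff_forall_notMem.mp huv) z ⟨hz, hzu, hzv⟩⟩
        · exact Or.inl ⟨hz, hzu⟩
      · rintro (⟨hz, _⟩ | ⟨hz, _⟩) <;> exact hz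
    rw [hcover, Set.union_sdiff_distrib]
    exact (hgood Z₁ hZ₁).union (hgood Z₂ hZ₂)
  -- generic point
  obtain ⟨ξ, hξ⟩ := QuasiSober.sober hirr Z₀.isClosed
  have hξZ : ∀ z, z ∈ (Z₀ : Set X) ↔ ξ ⤳ z := fun z =>
    ((isGenericPoint_iff_specializes.mp hξ) z).symm
  by_cases hξU : ξ ∈ U
  · obtain ⟨O, hO, hξO, hOU⟩ := h₂ ξ hξU
    rw [hξ.def] at hOU
    let Z' : Closeds X := ⟨(Z₀ : Set X) \ O, Z₀.isClosed.sdiff hO⟩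
    have hZ' : Z' < Z₀ := by
      rw [SetLike.lt_iff_le_and_exists]
      exact ⟨fun z hz => hz.1, ξ, (hξZ ξ).mpr specializes_rfl, fun h => h.2 hξO⟩
    have heq : (Z₀ : Set X) \ U = (Z' : Set X) \ U := by
      ext z
      simp only [Z', Closeds.coe_mk, Set.mem_sdiff]
      constructor
      · rintro ⟨hz, hzU⟩
        exact ⟨⟨hz, fun hzO => hzU (hOU ⟨hzO, hz⟩)⟩, hzU⟩
      · rintro ⟨⟨hz, _⟩, hzU⟩
        exact ⟨hz, hzU⟩
    rw [heq]
    exact hgood Z' hZ'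
  · have heq : (Z₀ : Set X) \ U = (Z₀ : Set X) := by
      ext z
      simp only [Set.mem_sdiff, and_iff_left_iff_imp]
      intro hz hzU
      exact hξU (h₁ ((hξZ z).mp hz) hzU)
    rw [heq]
    exact Z₀.isClosed

/-! ### Injectivity of `N_S ⊗_A X′ → N_S ⊗_A X` and `S`-torsion of the kernel -/

section Kernel

open TensorProduct

variable {A B : Type*} [CommRing A] [CommRing B] [Algebra A B]
  {N : Type*} [AddCommGroup N] [Module B N] [Module A N] [IsScalarTower A B N]

/-- **Localization over `B` commutes with `N ⊗_A (-)` and with kernels**: for a `B`-module `N`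
(an `A`-module by restriction), a submonoid `S ⊆ B`, a localization `N → N_S` at `S` and an
`A`-linear map `ι : X′ → X`, the map `N_S ⊗_A X′ → N_S ⊗_A X` is injective iff every element of
`Ker(N ⊗_A X′ → N ⊗_A X)` is killed by an element of `S` (Mathlib: `IsLocalizedModule.rTensor`,
`IsLocalizedModule.map_lTensor`, `LinearMap.ker_localizedMap_eq_localized₀_ker`). [folklore] -/
theorem injective_lTensor_iff_forall_exists_smul_eq_zero (S : Submonoid B) {NS : Type*}
    [AddCommGroup NS] [Module B NS] [Module A NS] [IsScalarTower A B NS] (g : N →ₗ[B] NS)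
    [IsLocalizedModule S g] {X' X : Type*} [AddCommGroup X'] [Module A X'] [AddCommGroup X]
    [Module A X] (ι : X' →ₗ[A] X) :
    Function.Injective (LinearMap.lTensor NS ι) ↔
      ∀ k ∈ LinearMap.ker (LinearMap.lTensor N ι), ∃ u : S, (u : B) • k = 0 := by
  have hmap := IsLocalizedModule.map_lTensor B S ι g
  have hker := LinearMap.ker_localizedMap_eq_localized₀_ker (p := S)
    (f := TensorProduct.AlgebraTensorModule.rTensor A X' g)
    (f' := TensorProduct.AlgebraTensorModule.rTensor A X g)
    (g := TensorProduct.AlgebraTensorModule.lTensor B N ι)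
  rw [hmap] at hker
  have hfun : ⇑(LinearMap.lTensor NS ι) = ⇑(TensorProduct.AlgebraTensorModule.lTensor B NS ι) := rfl
  rw [hfun, ← LinearMap.ker_eq_bot]
  change LinearMap.ker (TensorProduct.AlgebraTensorModule.lTensor B NS ι) = ⊥ ↔ _
  rw [hker, Submodule.eq_bot_iff]
  constructor
  · intro h k hk
    have h0 := h (IsLocalizedModule.mk' (TensorProduct.AlgebraTensorModule.rTensor A X' g) k 1)
      ((Submodule.mem_localized₀ _ _ _ _).mpr ⟨k, hk, 1, rfl⟩)
    rw [IsLocalizedModule.mk'_eq_zero'] at h0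
    obtain ⟨u, hu⟩ := h0
    exact ⟨u, by rw [← Submonoid.smul_def]; exact hu⟩
  · intro h y hy
    rw [Submodule.mem_localized₀] at hy
    obtain ⟨k, hk, s, rfl⟩ := hy
    rw [IsLocalizedModule.mk'_eq_zero']
    obtain ⟨u, hu⟩ := h k hk
    exact ⟨u, by rw [Submonoid.smul_def]; exact hu⟩

/-- A finitely generated submodule each of whose elements is killed by some element outside a
prime `Q` is killed by a single element outside `Q`. [folklore] -/
theorem exists_smul_eq_zero_of_fg {V : Type*} [AddCommGroup V] [Module B V] {K : Submodule B V}
    (hK : K.FG) (Q : Ideal B) [Q.IsPrime] (h : ∀ k ∈ K, ∃ u : Q.primeCompl, (u : B) • k = 0) :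
    ∃ b : B, b ∉ Q ∧ ∀ k ∈ K, b • k = 0 := by
  classical
  obtain ⟨s, hs⟩ := hK
  have hgen : ∀ k : ↥s, ∃ u : Q.primeCompl, (u : B) • (k : V) = 0 := fun k =>
    h k (hs ▸ Submodule.subset_span k.2)
  choose u hu using hgen
  let U : Q.primeCompl := ∏ k : ↥s, u k
  have hU : (U : B) = ∏ k : ↥s, (u k : B) := Submonoid.coe_finsetProd _ _ _
  refine ⟨U, U.2, ?_⟩
  intro k hk
  rw [← hs] at hk
  refine Submodule.span_induction ?_ ?_ ?_ ?_ hk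
  · intro v hv
    have : (U : B) = (∏ k ∈ (Finset.univ.erase ⟨v, hv⟩), (u k : B)) * u ⟨v, hv⟩ := by
      rw [hU]; exact (Finset.prod_erase_mul _ _ (Finset.mem_univ _)).symm
    rw [this, mul_smul, hu ⟨v, hv⟩, smul_zero]
  · exact smul_zero _
  · intro x y _ _ hx hy; rw [smul_add, hx, hy, add_zero]
  · intro c x _ hx; rw [smul_comm, hx, smul_zero]

end Kernel

/-! ### Generic flatness of `M/pM` over `A/p`, after inverting an element of `A ∖ p` -/

section GenericFlat

open TensorProduct

universe u

variable {A B : Type u} [CommRing A] [IsNoetherianRing A] [CommRing B] [Algebra A B]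
  [Algebra.FiniteType A B] (N : Type u) [AddCommGroup N] [Module B N] [Module A N]
  [IsScalarTower A B N] [Module.Finite B N] (p : Ideal A) [p.IsPrime]

/-- **Generic flatness of the fibre module** (from generic freeness, GW Thm. 10.83, applied to the
finite `B/pB`-module `N/pN` over the Noetherian domain `A/p`): there is `a ∈ A ∖ p` such that
`(A/p) ⊗_A N_a` is flat over `A/p`, where `N_a = N[1/a]`. [cite: GortzWedhorn2020, Thm. 10.83
with Thm. 10.84] -/
theorem exists_flat_quotient_tensor_localizedModule :
    ∃ a : A, a ∉ p ∧ Module.Flat (A ⧸ p)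
      ((A ⧸ p) ⊗[A] LocalizedModule (Submonoid.powers (algebraMap A B a)) N) := by
  classical
  let Ab := A ⧸ p
  let pB : Ideal B := p.map (algebraMap A B)
  let Bb := B ⧸ pB
  have hle : p ≤ pB.comap (algebraMap A B) := Ideal.le_comap_map
  let φ : Ab →+* Bb := Ideal.quotientMap pB (algebraMap A B) hle
  letI : Algebra Ab Bb := φ.toAlgebra
  haveI : IsScalarTower A Ab Bb := IsScalarTower.of_algebraMap_eq fun a => rfl
  haveI : Algebra.FiniteType A Bb :=
    Algebra.FiniteType.of_surjective (Ideal.Quotient.mkₐ A pB) (Ideal.Quotient.mkₐ_surjective A pB)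
  haveI : Algebra.FiniteType Ab Bb := Algebra.FiniteType.of_restrictScalars_finiteType A Ab Bb
  -- the fibre module `N/pN`
  let M' := N ⧸ (pB • ⊤ : Submodule B N)
  letI : Module Ab M' := Module.compHom M' φ
  haveI : IsScalarTower Ab Bb M' := IsScalarTower.of_algebraMap_smul fun r x => rfl
  haveI : Module.Finite Bb M' := Module.Finite.of_restrictScalars_finite B Bb M'
  haveI : IsNoetherianRing Ab := Ideal.Quotient.isNoetherianRing p
  -- generic freeness
  obtain ⟨ab, hab, hfree⟩ := GortzWedhorn2020_10_83_holds Ab Bb M' inferInstance inferInstance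
  obtain ⟨a, rfl⟩ := Ideal.Quotient.mk_surjective ab
  have ha : a ∉ p := fun h => hab (Ideal.Quotient.eq_zero_iff_mem.mpr h)
  refine ⟨a, ha, ?_⟩
  haveI := hfree
  haveI : Module.Flat Ab (Localization.Away (Ideal.Quotient.mk p a)) :=
    IsLocalization.flat _ (Submonoid.powers (Ideal.Quotient.mk p a))
  haveI hflat₁ : Module.Flat Ab (LocalizedModule (Submonoid.powers (Ideal.Quotient.mk p a)) M') :=
    Module.Flat.trans Ab (Localization.Away (Ideal.Quotient.mk p a)) _
  -- the target `(A/p) ⊗_A N_a` as a localization of `N/pN`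
  let Sa : Submonoid B := Submonoid.powers (algebraMap A B a)
  let Na := LocalizedModule Sa N
  let Ba := Localization Sa
  let V := Ab ⊗[A] Na
  let g₁ := (pB • ⊤ : Submodule B N).toLocalizedQuotient' Ba Sa (LocalizedModule.mkLinearMap Sa N)
  haveI : IsLocalizedModule (Algebra.algebraMapSubmonoid B (Submonoid.powers a)) g₁ := by
    rw [Algebra.algebraMapSubmonoid_powers]; infer_instance
  haveI h₁ : IsLocalizedModule (Submonoid.powers a) (g₁.restrictScalars A) :=
    IsLocalizedModule.restrictScalars (Submonoid.powers a) g₁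
  -- identify the localized submodule `(pB N)_a = p N_a`
  have hsub : ((pB • ⊤ : Submodule B N).localized' Ba Sa (LocalizedModule.mkLinearMap Sa N)).restrictScalars A =
      (p • ⊤ : Submodule A Na) := by
    rw [Submodule.localized'_smul, Submodule.localized'_top, Ideal.localized'_eq_map,
      Ideal.map_map, ← IsScalarTower.algebraMap_eq, Ideal.smul_restrictScalars,
      Submodule.restrictScalars_top]
  let θ : (Na ⧸ (pB • ⊤ : Submodule B N).localized' Ba Sa (LocalizedModule.mkLinearMap Sa N)) ≃ₗ[A] V :=
    ((Submodule.Quotient.restrictScalarsEquiv A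
        ((pB • ⊤ : Submodule B N).localized' Ba Sa (LocalizedModule.mkLinearMap Sa N))).symm.trans
      (Submodule.quotEquivOfEq _ _ hsub)).trans (TensorProduct.quotTensorEquivQuotSMul Na p).symm
  let ψA : M' →ₗ[A] V := θ.toLinearMap ∘ₗ g₁.restrictScalars A
  haveI hψA : IsLocalizedModule (Submonoid.powers a) ψA := inferInstance
  -- `ψA` is `A/p`-linear
  have hsmul : ∀ (r : A) (m : M'), (Ideal.Quotient.mk p r) • m = r • m := by
    intro r m
    change (φ (Ideal.Quotient.mk p r)) • m = r • m
    rw [Ideal.quotientMap_mk]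
    induction m using Submodule.Quotient.induction_on with
    | H n =>
      rw [Module.Quotient.mk_smul_mk, algebraMap_smul, Submodule.Quotient.mk_smul]
  let ψ : M' →ₗ[Ab] V :=
    { ψA with
      map_smul' := fun rb m => by
        obtain ⟨r, rfl⟩ := Ideal.Quotient.mk_surjective rb
        change ψA (Ideal.Quotient.mk p r • m) = Ideal.Quotient.mk p r • ψA m
        rw [hsmul, LinearMap.map_smul, ← algebraMap_smul Ab r (ψA m)]
        rfl }
  haveI : IsScalarTower A Ab M' := IsScalarTower.of_algebraMap_smul fun r x => hsmul r x
  haveI : IsLocalizedModule (Submonoid.powers a) (ψ.restrictScalars A) := hψA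
  haveI : IsLocalizedModule (Submonoid.powers (Ideal.Quotient.mk p a)) ψ := by
    have h := IsLocalizedModule.of_restrictScalars (Submonoid.powers a) ψ
    rw [Algebra.algebraMapSubmonoid_powers] at h
    exact h
  let iso := IsLocalizedModule.iso (Submonoid.powers (Ideal.Quotient.mk p a)) ψ
  exact Module.Flat.of_linearEquiv iso.symm

end GenericFlat

/-! ### Openness of the flat locus (Matsumura, Thm. 24.3) -/

section FlatLocus

open TensorProduct PrimeSpectrum

universe u

variable {A B : Type u} [CommRing A] [IsNoetherianRing A] [CommRing B] [Algebra A B]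
  [Algebra.FiniteType A B] (N : Type u) [AddCommGroup N] [Module B N] [Module A N]
  [IsScalarTower A B N] [Module.Finite B N]

omit [IsNoetherianRing A] [Algebra.FiniteType A B] [Module.Finite B N] in
/-- The flat locus, described by torsion of kernels: `N_Q` is flat over `A` iff for every ideal
`I ⊆ A`, every element of `Ker(N ⊗_A I → N)` is killed by an element of `B ∖ Q`. [folklore] -/
theorem flat_localizedModule_iff (Q : PrimeSpectrum B) :
    Module.Flat A (LocalizedModule Q.asIdeal.primeCompl N) ↔
      ∀ (I : Ideal A), ∀ k ∈ LinearMap.ker (LinearMap.lTensor N I.subtype),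
        ∃ u : Q.asIdeal.primeCompl, (u : B) • k = 0 := by
  rw [Module.Flat.iff_lTensor_injective']
  refine forall_congr' fun I => ?_
  exact injective_lTensor_iff_forall_exists_smul_eq_zero Q.asIdeal.primeCompl
    (LocalizedModule.mkLinearMap Q.asIdeal.primeCompl N) I.subtype

/-- **Openness of the flat locus** (Matsumura, *Commutative Ring Theory*, Thm. 24.3; The Stacks
Project, Tag 00RC in the Noetherian case): for a Noetherian ring `A`, a finitely generated
`A`-algebra `B` and a finite `B`-module `N`, the set of primes `Q` of `B` such that `N_Q` is
flat over `A` is open in `Spec B`. Proof by the topological Nagata criterion: stability under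
generalization is clear from `flat_localizedModule_iff`; if `N_P` is flat over `A` and
`p = P ∩ A`, then on a neighbourhood of `P` in `V(P)` both `Tor₁^A(A/p, N_Q) = 0` (the kernel of
`N ⊗ p → N` is finitely generated and dies at `P`) and `N_Q/pN_Q` is flat over `A/p` (generic
freeness, `exists_flat_quotient_tensor_localizedModule`), so that `N_Q` is flat over `A` by the
local criterion `flat_of_le_jacobson`. [cite: Matsumura1987, Thm. 24.3] -/
theorem isOpen_setOf_flat_localizedModule :
    IsOpen {Q : PrimeSpectrum B | Module.Flat A (LocalizedModule Q.asIdeal.primeCompl N)} := by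
  classical
  haveI : IsNoetherianRing B := Algebra.FiniteType.isNoetherianRing A B
  apply isOpen_of_stableUnderGeneralization_of_nhds_inter_closure
  · -- stable under generalization
    intro x y hyx hx
    rw [Set.mem_setOf_eq, flat_localizedModule_iff] at hx ⊢
    have hle : y.asIdeal ≤ x.asIdeal := (PrimeSpectrum.le_iff_specializes y x).mpr hyx
    intro I k hk
    obtain ⟨u, hu⟩ := hx I k hk
    exact ⟨⟨u, fun h => u.2 (hle h)⟩, hu⟩
  · -- the neighbourhood of a flat point inside its closure
    intro P hP
    rw [Set.mem_setOf_eq] at hP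
    let p : Ideal A := P.asIdeal.comap (algebraMap A B)
    haveI : p.IsPrime := Ideal.IsPrime.comap _
    -- generic flatness of the fibre
    obtain ⟨a, ha, hflat_a⟩ := exists_flat_quotient_tensor_localizedModule (B := B) N p
    -- `Tor₁^A(A/p, N)` dies on a neighbourhood of `P`
    let K : Submodule B (N ⊗[A] ↥p) :=
      LinearMap.ker (TensorProduct.AlgebraTensorModule.lTensor B N (Submodule.subtype p))
    haveI : Module.Finite B (N ⊗[A] ↥p) :=
      finite_tensorProduct_of_finite (R := A) (N := N) (B := B) ↥p
    have hKfg : K.FG := IsNoetherian.noetherian K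
    have hKP : ∀ k ∈ K, ∃ u : P.asIdeal.primeCompl, (u : B) • k = 0 :=
      ((flat_localizedModule_iff N P).mp hP) p
    obtain ⟨b, hb, hbK⟩ := exists_smul_eq_zero_of_fg hKfg P.asIdeal hKP
    -- the neighbourhood
    refine ⟨(basicOpen (b * algebraMap A B a) : Set (PrimeSpectrum B)), (basicOpen _).isOpen, ?_, ?_⟩
    · rw [SetLike.mem_coe, mem_basicOpen]
      exact (inferInstance : P.asIdeal.IsPrime).mul_notMem hb ha
    · rintro Q ⟨hQO, hQP⟩
      rw [SetLike.mem_coe, mem_basicOpen] at hQO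
      have hbQ : b ∉ Q.asIdeal := fun h => hQO (Q.asIdeal.mul_mem_right _ h)
      have haQ : algebraMap A B a ∉ Q.asIdeal := fun h => hQO (Q.asIdeal.mul_mem_left _ h)
      rw [PrimeSpectrum.closure_singleton, mem_zeroLocus] at hQP
      have hPQ : P.asIdeal ≤ Q.asIdeal := hQP
      rw [Set.mem_setOf_eq]
      -- the local criterion at `Q`
      let BQ := Localization.AtPrime Q.asIdeal
      let NQ := LocalizedModule Q.asIdeal.primeCompl N
      haveI : IsNoetherianRing BQ :=
        IsLocalization.isNoetherianRing Q.asIdeal.primeCompl BQ inferInstance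
      haveI : Module.Finite BQ NQ := Module.Finite.of_isLocalizedModule Q.asIdeal.primeCompl
        (LocalizedModule.mkLinearMap Q.asIdeal.primeCompl N)
      have hJ : p.map (algebraMap A BQ) ≤ (⊥ : Ideal BQ).jacobson := by
        refine le_trans ?_ (IsLocalRing.maximalIdeal_le_jacobson ⊥)
        rw [Ideal.map_le_iff_le_comap]
        intro x hx
        rw [Ideal.mem_comap, ← Localization.AtPrime.map_eq_maximalIdeal,
          IsScalarTower.algebraMap_apply A B BQ]
        exact Ideal.mem_map_of_mem _ (hPQ hx)
      have hi : Function.Injective (LinearMap.lTensor NQ (Submodule.subtype p)) := by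
        rw [injective_lTensor_iff_forall_exists_smul_eq_zero Q.asIdeal.primeCompl
          (LocalizedModule.mkLinearMap Q.asIdeal.primeCompl N)]
        intro k hk
        exact ⟨⟨b, hbQ⟩, hbK k hk⟩
      have hii : ∀ 𝔠' : Ideal (A ⧸ p),
          Function.Injective (LinearMap.lTensor NQ (𝔠'.subtype.restrictScalars A)) := by
        intro 𝔠'
        rw [injective_lTensor_iff_forall_exists_smul_eq_zero Q.asIdeal.primeCompl
          (LocalizedModule.mkLinearMap Q.asIdeal.primeCompl N)]
        intro k hk
        have hinj_a := lTensor_injective_of_flat_baseChange (R := A)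
          (N := LocalizedModule (Submonoid.powers (algebraMap A B a)) N) (S := A ⧸ p) 𝔠'
        rw [injective_lTensor_iff_forall_exists_smul_eq_zero (Submonoid.powers (algebraMap A B a))
          (LocalizedModule.mkLinearMap (Submonoid.powers (algebraMap A B a)) N)] at hinj_a
        obtain ⟨⟨u, n, rfl⟩, hu⟩ := hinj_a k hk
        exact ⟨⟨algebraMap A B a ^ n, fun h => haQ
          ((inferInstance : Q.asIdeal.IsPrime).mem_of_pow_mem n h)⟩, hu⟩
      exact flat_of_le_jacobson (R := A) (B := BQ) (N := NQ) p hJ hi hii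

end FlatLocus

end Literature.RingTheory.Flat
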